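import Summits.HodgeConjecture.HodgeConjecture.Theses.KuznetsovCYFactory
import Literature.AlgebraicGeometry.HodgeTheory.FermatHypersurfaceReduction

/-!
# Route KuznetsovCYFactory — `AlgebraicClassesIsoInvariant` (support item stmt-HodgeConjecture-1885)

Algebraic classes are transported along isomorphisms of `ℂ`-schemes: for `e : X ≅ Y` and
`c ∈ algebraicClasses Y p`, the pull-back `e^* c` lies in `algebraicClasses X p` — the tree's
`mem_algebraicClasses_map_iff_of_iso` (isomorphisms are homeomorphisms on complex points preserving
the codimension of scheme points, so they transport the support filtration).  No named-fact
hypothesis, no sorry.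
-/

-- `Summit.HodgeConjecture.HodgeConjecture.Theorems` is the mandated namespace (single-problem
-- summit: Problem = Summit), which `linter.dupNamespace` flags on every declaration; the lakefile
-- turns the linter off tree-wide (weak option), restated here so stand-alone elaboration is
-- warning-free too.
set_option linter.dupNamespace false

namespace Summit.HodgeConjecture.HodgeConjecture.Theorems

open Literature.AlgebraicGeometry.HodgeTheory

/-- **Item stmt-HodgeConjecture-1885 (`AlgebraicClassesIsoInvariant`), route `KuznetsovCYFactory`**:
`c ∈ algebraicClasses Y p ⟹ e^* c ∈ algebraicClasses X p` for an isomorphism `e : X ≅ Y`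
(`mem_algebraicClasses_map_iff_of_iso`). [cite: Hartshorne1977, II Ex. 3.11 (d)] -/
theorem kuznetsovCYFactory_algebraicClassesIsoInvariant_proof :
    Summit.HodgeConjecture.HodgeConjecture.Theses.KuznetsovCYFactory.AlgebraicClassesIsoInvariant :=
  fun _X _Y e _p _c hc ↦ (mem_algebraicClasses_map_iff_of_iso e).2 hc

end Summit.HodgeConjecture.HodgeConjecture.Theorems
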